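import Summits.QuantumFields.YangMills.Theorems.BalabanUVNodesK0AxJoinTRecord

/-!
# LANDING NOTE (porter PTC-1 g3, 2026-08-31; AUTHORSHIP = ◇ lens-1 g9 «cauchy-analytic», HOME sketch `nodeO-cover/LENS-1g9-JoinT-v2.lean` sha16 b7b49705adbb81b3 · 725 l. · 0 sorry;
# ★★★ director-ym №527 (b) ∕ №533 ∕ №535; ◆ CRIT-1 g36 CUT ON v2 = PASS 08:30:26Z (J1′ per hypothesis incl. inhabitability of (G0)–(G4) at the record with
# `Nin := recordRNat`, `Rsep := recordR∕2 − 2Mc`, `cR := 1∕16`, `Mg ≥ 4Mc`; J5′; axioms standard) with «§K∕§K2 landable NOW as a fourth helper file»).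
# THIS FILE `…K0AxJoinTKStep.lean` = v2's §K VERBATIM: `flipJC`, `flipJC_e`, `response9D_flipJC`, `chart_cut_members_JC`, ★★★ `recordTwoVol_of_rows_JC` and ★★★
# `kstep_joinT_at_record` — the kernel step AT THE RECORD, PROVED: from the DISPLAYED rows D1 (⁸'s `FormatPlusG` mould at `recordEmbJ` on `]0, γ₀]`-runs = [R-W]'s consequent,
# OPEN), the swap row to `ιC`, D9 `∀ k a, Response9DAtJC …` (centred, OPEN Bałaban (R4ᴰ)-type content), D13 identities + the `recordGkJC` link, geometry (G0)–(G4) with a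
# DISPLAYED seam separation `Rsep k n ≥ cR·recordN`, leaves (δ₀∕4, κ∕4) ⟹ [E] `K0AxTwoVolumeRate.RecordPvolTwoVolExpOnRunsAx F a₀ ε₂₉ γ₀ (48E₀C₉²K₀′K₁ + 32E₀C₉²e^{δ₁Mg c₁}K₀′K₁) (δ₁·cR)`.
# Companions (same namespace `…Theorems.K0AxJoinT`): ✓p816700 `…K0AxJoinTLeaves` (§A + §B), ✓p816793 `…K0AxJoinT` (§C + §D), `…K0AxJoinTRecord` (§E) — landed from v1.1, whose
# 17 declarations are byte-identical in v2 (◆'s declcmp).  The author's v2 module docstring follows unchanged (it supersedes the v1.1 docstring carried by `…Leaves` where they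
# differ: §K is now PROVED, not a `sorry`).  HONEST: a CHECKED IMPLICATION between displayed hypotheses; [E] is inhabited unconditionally NOWHERE (⁸ and `Response9DAtJC` OPEN);
# K0ᴬ stmt-QuantumFields-27238 is thereby REDUCED BY NAME to port ∕ definition ∕ geometry rows — NOTHING of it is proved; nothing of Bałaban asserted, ported, discharged or refuted;
# NODE O 0∕1; COUNT 8∕28 · K 1∕4 UNMOVED; finite 𝕋⁴ at fixed ε — NOT continuum ∕ OS ∕ Clay; the Yang–Mills mass gap is NOT proved by any of this.
-/

/-!
# LENS-1 g9 «cauchy-analytic» — JOIN-T v2′: THE TWO-VOLUME KERNEL CLAUSE «⁸'s mould + (D)-road response rows ⇒ [E]», TYPED AND PROVED (0 sorry)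
(unit `ymgap-nodeO-lens-1-g9`, GEN 9; HOME sketch `nodeO-cover/LENS-1g9-JoinT-v2.lean` (v1∕v1.1 = the same with §K declared `sorry`), nobody's tree file; count-neutral; director-ym №527 (b) ∕ №526 (iii) re-pointed by ◇ g8)

[I] = [Balaban1987RG1], [15] = [Balaban1985Variational].

WHAT v2′ IS.  ★★★ №527 (b): «v2′ = JOIN-T kernel clause [R-W] + ◆-admitted (D) response rows (+ P9-reg + (R4ᴰ)′) ⇒ [E]», [E] = `K0AxTwoVolumeRate.RecordPvolTwoVolExpOnRunsAx`
(✓p814710 :231), [F] := [R-W] verbatim (no new primitive letter).  ◇ g8 located why v2-as-ordered is not constructible (no polymer∕activity level is NAMED below `(Ψ, Ew)`) and why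
«[R-W] ⇒ [E]» alone fails (the pieces are evaluated at the VOLUME-DEPENDENT background pair; the two-volume comparison of that pair is (D)-road content).  This file types the
clause at the CHART level — the currency in which the (D) road's JOIN of record ALREADY runs (✓`PortH.decay510_plimOf_of_rows_trace` per volume; [R-W] ⇒ ⁸ is
✓`BalabanUVNodesPortS1.sig27930v8LR4_of_residueAtW`, and ⁸'s consequent `FormatPlusG … R.wrap R.emb R.πc E₀ κ` carries `PieceVolIndep` next to `Analytic19 ∕ Bound118 ∕ Local17 ∕ Repr17 ∕
GaugeInv119`) — as the TWO-VOLUME SIBLING of that theorem: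

  ★★ `abs_polComp_succ_sub_polComp_le_of_rows` (per colour) ∕ ★★★ `twoVol_pvolOf_of_rows_trace` (trace):
  (1.19)-mould pieces `E` (Analytic19, Bound118, Local17, Repr17 at every member, Ward414, PieceVolIndep) ∧ `Chart44D` ∧ (A3) cut ∧ PER-COLOUR rows
  { (R1ᴰ)ₙ gauge decay `hdec`, (R3) `hunwrap`, (R4ᴰ) two-volume gauge comparison on the window `hcmp`, (R5) intertwining `hI` } ∧ the colour-indexed response link `hL` ∧
  THREE GEOMETRIC ROWS { (G0) `emb n` injective off the wrap class; (G1) wrap-class domains are LARGE-OR-FAR from inner-window labels: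
  `Rsep n ≤ dist(e n μ z, X) + Mg·(d_j X + c₁)`; (G2) member-(n+1) domains that are NOT images are LARGE-OR-FAR likewise } ∧ leaves (cube-sum at δ₀∕4, tree at κ∕4)
  ⟹ for inner-window `z`:  `|Πₙ₊₁(μ,z;ν,0) − Πₙ(μ,z;ν,0)| ≤ 48·E₀C₉²K₀K₁·e^{−δ₀Nₙ∕2} + 32·E₀C₉²e^{δ₁Mg c₁}K₀K₁·e^{−δ₁·Rsep n}`, `δ₁ = delta1 δ₀ κ Mg`.

  PROOF = the printed sentence [I] p.264 «This limit exists by the localized representation (1.7)» made quantitative, in three terms (◇ g6 `LENS-1-D4VolumeCauchy-v1.6` §7–§9, INTENT-26):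
  (U) MATCHED PART off the wrap class — SAME Hessian `D²(E_X∘χ_X)(0)` at both members (`PieceVolIndep` + (R5) + `mixedDeriv_comp_clm` = `mixedDeriv_nextMember_eq`), arguments
      near-stable by (R4ᴰ) ((R3) aligns the cut), Cauchy-bilinear in the gauge of the (4.4) domain (`kernelBound_twoVolume_of_gauge`) ⟹ a `KernelBound` with constant ∝ `e^{−δ₀N∕2}`;
  (W₁)(W₂) TAILS — member n's wrap class, member (n+1)'s non-image domains: the single-volume `KernelBound` (✓`B12Decay510Gauge.kernelBound_of_gauge`) MASKED to a LARGE-OR-FAR class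
      (`kernelBound_maskKernel_of_largeOrFar`, NEW: half of each rate pays `e^{−δ₁Rsep}`) — NO «wrap domains are large» claim (a seam cube is small but far; a long domain is near but large);
  all three resummed by ✓`B12Decay510.sum_abs_le` at `δ₁ := 0` (`sum_abs_le_const`); split = `abs_sum_next_sub_sum_le_three`; trace average as in the (5.10) road.
  (4.14) kills the `D(E∘χ)(0)[D²ι]` term, so NO second-order response row is needed (same as the decay road: `ofReal_fderiv_fderiv_eq_sum_mixedDeriv_of_repr`).

§E AT THE RECORD (bookkeeping, sorry-free): `twoRate_le`, `eventually_atTop_of_add`, `recordPvolTwoVolExpOnRunsAx_of_eventually ∕ _of_le_radius ∕ _of_members` (member-indexed two-rate bound + `cR·recordN ≤ Rsep`, `recordN∕4 ≤ recordRNat` ⟹ [E] at rate `δ₁·cR`);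
★★★ `joinConclLimR_of_decayConclR_twoVolExp` — the IN-SCOPE output: the radius-uniform decay JOIN's consequent (✓`PortHRecordJoin.decayConclR_of_texts` shape) carrying, under the
SAME `∃ γ₀ ε₂₉`, the letter [E] at every `γ ≤ γ₀` ⟹ `JoinConclLimR Tok F` (✓`joinConclLimR_of_decayConclR` + ✓`recordPolLimitOnRunsAx_of_twoVolExp`); then K0ᴬ BY NAME is the tree's
✓`decayLetter_of_lim` ∕ ✓`K0AxJoinResidual.record13SepCoPHInhabitedAx_of_lim_residual[_tokFree]` (not restated).  WHY NOT the ✓p814710 :279 door: its `hE` is the TWO-SUPPLIER threshold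
form `∃ εL ∀ ε₂₉ ≤ εL ∃ γ₀ …`, which ⁸∕[R-W] (ONE `∃ γ₀ ε₂₉ …`, `thetaFill ∕ recordW ∕ betaOfRecord₁₃Ax` all ε₂₉-dependent) cannot feed honestly (◇ g9 07:38Z, ■ REF (1348) CONFIRMED).

§K THE KERNEL STEP AT THE RECORD — PROVED (v2; v1 had it as the one declared `sorry`): `kstep_joinT_at_record` — ★★★ instantiated at the record names along in-interval runs
(member `n` = volume `recordK₀ F Mc k + n`) via the `flipJC` device (`flipJC ∕ flipJC_e ∕ response9D_flipJC ∕ chart_cut_members_JC` = the JOIN's `flipL` lemmas for the centred pair) and the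
member-level ★★★ `recordTwoVol_of_rows_JC`, in the hypothesis style of ✓`PortHRecordJoin.recordPlimDecayOnRunsAx_of_trace_L` (one dressed chart `ιC` + swap row), typed AGAINST ◆ CRIT-1 g36's price sheet
`Cruxes/Record13SepCoPHInhabited/CRIT-1-DROWS-v2prime-g36.md`: D1 ⁸'s `FormatPlusG` mould VERBATIM (at `recordEmbJ`), D9 the CENTRED-PAIR receipt ✓`Response9DAtJC` of ★★ DEF-1 ed.19
`…K0RecordFormatNamesCentredPair` (per colour; window `recordRNat`; centred in BOTH blocks — J5′ EXEMPT column), D13 identities (`IotaRowAt`-type for `ιC`, the response link on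
`recordGkJC`, the swap row), geometry rows (G0)–(G4) at `recordWrapCtr ∕ recordDomEmbCtr ∕ recordSiteGeom ∕ recordE ∕ recordRNat ∕ recordN` with a DISPLAYED seam separation `Rsep k n ≥ cR·recordN`, leaves at (δ₀∕4, κ∕4);
NO `…FromCtr ∕ FromJ ∕ FromL`, NO `Response9DAtL ∕ ConsumerC1 ∕ TokP9L4New ∕ TokRest4`, NO `= … univ` bridge (sheet §4 (2)).  ON THE SHEET's §3 «LOCATED GAP G-v2′-1» (second-order
rows): it does NOT arise on this road — (4.14) `Ward414` (from ⁸'s `GaugeInv119` + RowG's `ChartEquivariant ∕ NoInvariantCovector`, ✓`BalabanUVNodesPortS1.ward414_of_gaugeInv119_chart44D`)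
kills the `piece′[D²ι]` term inside ✓`B12Eq435SecondVariation.ofReal_fderiv_fderiv_eq_sum_mixedDeriv_of_repr`, so the kernel entry is `Σ_X Re (E_X∘χ_X)″(0)[cut Dι·p, cut Dι·q]` —
FIRST-ORDER responses only, at both volumes (★ `polComp_eq_sum_re_mixedDeriv_dir`, the `(μ, ν)`-general twin of the (5.10) road's ✓`PortH.polComp_diag_eq_sum_re_mixedDeriv`); the
two-volume defect needed is that of `Dι` ((R4ᴰ), first order), never of `D²ι`.  The sheet's cheapest falsifier («first order right, arbitrary non-decaying second order `U_lin·exp(q(B)T)`»)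
is answered by the hypothesis list itself: such a family violates `GaugeInv119`-derived (4.14) or `Repr17` for the SAME pieces, both displayed (⁸); with them, no second-order datum enters.

WHAT ENGINE C ALREADY EXCLUDES ∕ THE NUMBER THAT KEEPS OR KILLS THIS (bus rule): W3 kit j343242 rc 0 measured the two-volume increments of the K=0,1 toy kernels EXP-IN-PERIOD
(k0: ρ = 0.0487 per blocking, κ_block = 3.021; k1: κ_block = 2.675) — consistent with ★★★'s shape `A·e^{−δ₀N∕2} + B·e^{−δ₁Rsep}` and NOT with a power law; the NEW number is the
R-line «seam dominance»: the ratio of the wrap-class tail (W₁) to the matched part (U) at fixed z as N doubles — ★★★ predicts BOTH decay at rate ≥ min(δ₀∕2, δ₁·Rsep∕N)·N; a measured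
(W₁)∕(U) growing like e^{+cN} would kill the LARGE-OR-FAR bookkeeping (G1) at the record (orderable from ttrl7∕ttrl10 by splitting the toy's domain sum at the seam).

HONEST FRAMING.  CONDITIONAL theorems over DISPLAYED row predicates (all hypotheses) + generic folklore; NO `sorry` (v2: the record instantiation §K is proved; [E] follows from the
DISPLAYED rows — ⁸'s OPEN consequent, DEF-1's OPEN centred receipt `Response9DAtJC`, identities, geometry — by a checked theorem, and is inhabited UNCONDITIONALLY nowhere); nothing of Bałaban ([I] Thm 1, (1.7), (1.18)–(1.22), (4.33)–(4.37), (5.10); [15] Thm 1, Prop. 9, (190)) is asserted, ported, discharged or refuted;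
K0⁷ stmt-QuantumFields-20541 ∕ K0ᴬ stmt-QuantumFields-27238 OPEN; NODE O 0∕1; COUNT 8∕28 · K 1∕4 UNMOVED; finite `𝕋⁴_{L^K}` at fixed ε — NOT continuum ∕ ℝ⁴ ∕ OS ∕ Clay;
**the Yang–Mills mass gap is NOT proved by any of this.**  No `instance`, `notation`, `allowUnsafeReducibility`; standard axioms.
-/

noncomputable section

open Filter Topology
open scoped BigOperators Matrix.Norms.L2Operator

namespace Summit.QuantumFields.YangMills.Theorems.K0AxJoinT

open Literature.MathematicalPhysics.QuantumFieldTheory.Balaban1983to89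
open Literature.MathematicalPhysics.QuantumFieldTheory.Balaban1983to89.Node00 (TermFamily1 siteOfInt polWindow polScalar betaOfRecord₁₃Ax Stage13Params)
open Literature.MathematicalPhysics.QuantumFieldTheory.Balaban1983to89.T4Continuum (T4Family)
open Literature.MathematicalPhysics.QuantumFieldTheory.Balaban1983to89.B12FormatPlus
open Literature.MathematicalPhysics.QuantumFieldTheory.Balaban1983to89.B12Decay510 (SiteGeometry GeomLeaf CubeSumLeaf TreeLeaf KernelBound delta1 mixedDeriv
  sum_abs_le delta1_le_half delta1_mul_le delta1_nonneg)
open Literature.MathematicalPhysics.QuantumFieldTheory.Balaban1983to89.B12Decay510Gauge (norm_mixedDeriv_le_gauge kernelBound_of_gauge)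
open Literature.MathematicalPhysics.QuantumFieldTheory.Balaban1983to89.B12Decay510TwoVolume (kernelBound_twoVolume_of_gauge mixedDeriv_nextMember_eq maskKernel
  sum_filter_abs_eq_sum_abs_maskKernel comapLabels abs_sum_next_sub_sum_le_three)
open Literature.MathematicalPhysics.QuantumFieldTheory.Balaban1983to89.B12Eq435SecondVariation (ofReal_fderiv_fderiv_eq_sum_mixedDeriv_of_repr)
open Literature.MathematicalPhysics.QuantumFieldTheory.Balaban1983to89.Beta.RemainderLocality (mixedDeriv_comp_clm mixedDeriv_eq_fderiv_fderiv
  differentiableAt_fderiv_of_analyticAt)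
open Summit.QuantumFields.YangMills.Theorems.K0RecordFormatNames (ΦfOf pvolOf plimOf)
open Summit.QuantumFields.YangMills.Theorems.PortH (exists_cutTo_clm pvolOf_eq_trace)

/-! ## §K  THE KERNEL STEP AT THE RECORD, PROVED — ★★★ instantiated at the record names, CENTRED (◆ CRIT-1 g36 price sheet `Cruxes/Record13SepCoPHInhabited/CRIT-1-DROWS-v2prime-g36.md`:
rows D1 (⁸'s `FormatPlusG` mould, verbatim), D9 (`Response9DAtJC` on ★★ DEF-1 ed.19's centred-PAIR literal), D13 (identities: `IotaRowAt`-type, the response link on `recordGkJC`,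
the swap row), geometry; NO `…FromCtr∕FromJ∕FromL`, NO `Response9DAtL`, NO `TokP9L4New∕TokRest4`, NO `= … univ` bridge).  G-v2′-1 («second-order rows») does NOT arise: (4.14)
`Ward414` (⁸'s `GaugeInv119` + RowG, ✓`BalabanUVNodesPortS1.ward414_of_gaugeInv119_chart44D`) kills `piece′[D²ι]` in ✓`ofReal_fderiv_fderiv_eq_sum_mixedDeriv_of_repr`, exactly as on
the (5.10) road of record — the kernel is `Σ_X Re (E_X∘χ_X)″(0)[cut Dι·p, cut Dι·q]`, FIRST-order responses only (★ `polComp_eq_sum_re_mixedDeriv_dir`). -/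

section KernelStep

open Summit.QuantumFields.YangMills.Theorems.K0RecordFormatNames
open Summit.QuantumFields.YangMills.Theorems.K0AxTwoVolumeRate (RecordPvolTwoVolExpOnRunsAx)
open Summit.QuantumFields.YangMills.Theorems.PortHRecordJoin (formatPlusG_chartSwap chartEquivariant_members noInvariantCovector_members chart_cut)
open Summit.QuantumFields.YangMills.Theorems.K0PortChart44DAtRecord (chart44DJ_record)
open Literature.MathematicalPhysics.QuantumFieldTheory.Balaban1983to89.FlowStep
open Literature.MathematicalPhysics.QuantumFieldTheory.Balaban1983to89.FlowStepRuns

/-- **`flipJC F θ a Mc k K₀`** — ★★ DEF-1 ed.19's centred-PAIR response data from the base volume `K₀` (`recordResponse9DataFromJC`: `Gk := recordGkJC`, both blocks centred — J5′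
EXEMPT column; every other field the record's) with the WINDOW LABELS in ★★★'s convention `e n μ z := (μ, siteOfInt z)` (the JOIN's `flipL` device, verbatim, for the centred pair).
[cite: Balaban1985Variational, Prop. 9 p.309; Balaban1987RG1, (1.21) p.264, (4.35) p.290] -/
def flipJC (F : T4Family) (θ : Stage13Params F 2) (a : θ.ιβ) (Mc k K₀ : ℕ) :
    Response9Data (fun n => recordDomSys F Mc k (K₀ + n)) (fun n => recordBondCount F (K₀ + n)) (fun n => recordChartDimJ F (K₀ + n)) 4 :=
  { recordResponse9DataFromJC F θ a Mc k K₀ with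
    e := fun n μ z => (Fin.cast (F.P_d (K₀ + n)).symm μ, siteOfInt F (K₀ + n) (k + 1) z) }

/-- The flipped label IS the record label at `−z`. [cite: Balaban1987RG1, (1.21) p.264 (bookkeeping)] -/
theorem flipJC_e (F : T4Family) (θ : Stage13Params F 2) (a : θ.ιβ) (Mc k K₀ n : ℕ) (μ : Fin 4) (z : Fin 4 → ℤ) :
    (flipJC F θ a Mc k K₀).e n μ z = recordE F k (K₀ + n) μ (-z) := by
  simp only [flipJC, recordE, neg_neg]

/-- ★ DEF-1's receipt `Response9DAtJC` (BY NAME) transfers to `flipJC` — only (R4ᴰ) reads `e`, under a `|·|`-symmetric window guard (the JOIN's `response9D_flipL`, verbatim).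
[cite: Balaban1985Variational, Prop. 9 p.309; Balaban1987RG1, (1.21) p.264, (4.4) p.281] -/
theorem response9D_flipJC (F : T4Family) (θ : Stage13Params F 2) (a : θ.ιβ) (Mc k K₀ : ℕ) {α₂ C₉ δ₀ : ℝ}
    (h : Response9DAtJC F θ a Mc k K₀ α₂ C₉ δ₀) :
    Response9D (flipJC F θ a Mc k K₀) (fun n => recordChartJ F Mc k (K₀ + n)) (fun n => recordRNat F Mc k (K₀ + n))
      (fun n X => recordDom44J F Mc k (K₀ + n) X α₂) C₉ δ₀ := by
  obtain ⟨h0, h1, hR1, hR3, hR4, hR5⟩ := h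
  refine ⟨h0, h1, hR1, hR3, fun n X hX μ z hz => ?_, hR5⟩
  have hz' : ∀ l, 2 * |(-z) l| < (recordRNat F Mc k (K₀ + n) : ℤ) := fun l => by simpa only [Pi.neg_apply, abs_neg] using hz l
  have h4 := hR4 n X hX μ (-z) hz'
  simp only [flipJC_e]
  exact h4

/-- Cut-locality at the members for `flipJC`'s `cX` (= `recordCXJ`, definitional), every `coords`. [cite: Balaban1987RG1, (4.35) p.290] -/
theorem chart_cut_members_JC (F : T4Family) (θ : Stage13Params F 2) (a : θ.ιβ) (Mc k K₀ : ℕ)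
    (coords : (n : ℕ) → (recordDomSys F Mc k (K₀ + n)).Dom → Finset (Fin (recordBondCount F (K₀ + n)))) :
    ∀ n X u, ∀ i ∈ coords n X,
      recordChartJ F Mc k (K₀ + n) X (cutTo ((flipJC F θ a Mc k K₀).cX n X) u) i = recordChartJ F Mc k (K₀ + n) X u i := by
  intro n X u i _
  show recordChartJ F Mc k (K₀ + n) X (cutTo (recordCXJ F Mc k (K₀ + n) X) u) i = _
  rw [chart_cut]

/-- ★★★ **MEMBER LEVEL, ONE CENTRED CHART `ιC`** — ★★★ `twoVol_pvolOf_of_rows_trace` AT THE RECORD NAMES (the JOIN's `recordDecay_of_trace_L` pattern: `R := flipJC F θ a⋆ …`, every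
non-`Gk` field colour-blind, `Gc n a := recordGkJC … a`): ⁸'s mould at `recordEmbJ` ∧ the swap row to `ιC` ∧ `∀ a, Response9DAtJC …` ∧ the identities for `ιC ∕ recordGkJC` ∧ geometry
(G0)–(G3) ∧ leaves ⟹ for every `(μ, ν, z)`, EVENTUALLY along the members, the two-rate bound on `recordPvolAx (K₀+m+1) − recordPvolAx (K₀+m)`.  CONDITIONAL over displayed rows;
nothing of Bałaban asserted. [cite: Balaban1987RG1, (1.21) p.264, (1.18)–(1.19) p.263, (1.7) p.261, (4.14) p.284, (4.35)–(4.37) pp.290–291, (5.10) p.293; Balaban1985Variational, Prop. 9 p.309] -/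
theorem recordTwoVol_of_rows_JC {E₀ κ C₉ δ₀ Mg c₁ K₀' K₁ : ℝ}
    (hE₀ : 0 ≤ E₀) (hκ : 0 < κ) (hC₉ : 0 ≤ C₉) (hδ₀ : 0 < δ₀) (hMg : 0 < Mg) (hK₀' : 0 ≤ K₀') :
    ∀ (F : T4Family) (a₀ ε₂₉ α₀ α₁ : ℝ), 0 < α₀ → 0 < α₁ → ∀ (Mc k : ℕ) (v : Fin (k + 1) → ℝ) (Nin : ℕ → ℕ) (Rsep : ℕ → ℝ),
      letI θ := thetaFill F a₀ ε₂₉; letI := θ.instVβ₁; letI := θ.instVβ₂; letI := θ.instιβ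
      ∀ ιC : (n : ℕ) → recordW F a₀ ε₂₉ k (recordK₀ F Mc k + n) → (Fin (recordChartDimJ F (recordK₀ F Mc k + n)) → ℂ),
      B12FormatPlus.FormatPlusG (fun n => recordDomSys F Mc k (recordK₀ F Mc k + n)) (fun n => recordBondCount F (recordK₀ F Mc k + n))
          (fun n => recordAct F (recordK₀ F Mc k + n)) (fun n => recordUc F Mc k α₀ α₁ (recordK₀ F Mc k + n))
          (fun n => recordCoords F Mc k (recordK₀ F Mc k + n)) (fun n => recordChartDimJ F (recordK₀ F Mc k + n))
          (fun n => recordChartJ F Mc k (recordK₀ F Mc k + n)) (fun n => recordΦfAx F a₀ ε₂₉ k v (recordK₀ F Mc k + n))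
          (fun n => recordEmbJ F θ k (recordK₀ F Mc k + n)) (fun n => recordWrapCtr F Mc k (recordK₀ F Mc k + n))
          (fun n => recordDomEmbCtr F Mc k (recordK₀ F Mc k + n)) (fun n _ => recordCoordProjCtr F (recordK₀ F Mc k + n)) E₀ κ →
      (∀ n : ℕ, ∀ᶠ B in 𝓝 (0 : recordW F a₀ ε₂₉ k (recordK₀ F Mc k + n)), ∀ X : (recordDomSys F Mc k (recordK₀ F Mc k + n)).Dom,
          ∃ g : recordGaugeGrp F (recordK₀ F Mc k + n), ∀ i ∈ recordCoords F Mc k (recordK₀ F Mc k + n) X,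
            recordChartJ F Mc k (recordK₀ F Mc k + n) X (ιC n B) i =
              recordAct F (recordK₀ F Mc k + n) g (recordChartJ F Mc k (recordK₀ F Mc k + n) X (recordEmbJ F θ k (recordK₀ F Mc k + n) B)) i) →
      (∀ a : θ.ιβ, Response9DAtJC F θ a Mc k (recordK₀ F Mc k) (min (1 / 4 : ℝ) (min α₁ (α₀ / 36))) C₉ δ₀) →
      (∀ n : ℕ, ContDiffAt ℝ 2 (ιC n) 0 ∧ ιC n 0 = 0) →
      (∀ (n : ℕ) (a : θ.ιβ) (l : RespLabel F k (recordK₀ F Mc k + n)),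
          recordGkJC F θ k (recordK₀ F Mc k + n) a l = fun i => fderiv ℝ (ιC n) 0 (Pi.single l.1 (Pi.single l.2 (θ.bV a))) i) →
      (∀ n : ℕ, Set.InjOn (recordDomEmbCtr F Mc k (recordK₀ F Mc k + n)) {X | X ∉ recordWrapCtr F Mc k (recordK₀ F Mc k + n)}) →
      (∀ (n : ℕ) (X : (recordDomSys F Mc k (recordK₀ F Mc k + n)).Dom), X ∈ recordWrapCtr F Mc k (recordK₀ F Mc k + n) →
          ∀ (μ : Fin 4) (z : Fin 4 → ℤ), (∀ l, 2 * |z l| < (Nin n : ℤ)) →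
            Rsep n ≤ (recordSiteGeom F Mc k (recordK₀ F Mc k + n)).distD (recordE F k (recordK₀ F Mc k + n) μ z) X +
              Mg * ((recordDomSys F Mc k (recordK₀ F Mc k + n)).dj X + c₁)) →
      (∀ (n : ℕ) (X' : (recordDomSys F Mc k (recordK₀ F Mc k + (n + 1))).Dom),
          (∀ X, X ∉ recordWrapCtr F Mc k (recordK₀ F Mc k + n) → recordDomEmbCtr F Mc k (recordK₀ F Mc k + n) X ≠ X') →
          ∀ (μ : Fin 4) (z : Fin 4 → ℤ), (∀ l, 2 * |z l| < (Nin n : ℤ)) →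
            Rsep n ≤
              (recordSiteGeom F Mc k (recordK₀ F Mc k + (n + 1))).distD (recordE F k (recordK₀ F Mc k + (n + 1)) μ z) X' +
                Mg * ((recordDomSys F Mc k (recordK₀ F Mc k + (n + 1))).dj X' + c₁)) →
      (∀ n : ℕ, Nin n ≤ recordRNat F Mc k (recordK₀ F Mc k + n)) → (∀ z : Fin 4 → ℤ, ∀ᶠ n in atTop, ∀ l, 2 * |z l| < (Nin n : ℤ)) →
      (∀ n : ℕ, B12Decay510.CubeSumLeaf (recordSiteGeom F Mc k (recordK₀ F Mc k + n)) (δ₀ / 4) K₁ ∧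
          B12Decay510.TreeLeaf (recordCc F Mc k (recordK₀ F Mc k + n)) (κ / 4) K₀') →
      ∀ (μ ν : Fin 4) (z : Fin 4 → ℤ), ∀ᶠ m in atTop,
        |recordPvolAx F a₀ ε₂₉ k v (recordK₀ F Mc k + (m + 1)) μ ν z - recordPvolAx F a₀ ε₂₉ k v (recordK₀ F Mc k + m) μ ν z| ≤
          48 * E₀ * C₉ ^ 2 * K₀' * K₁ * Real.exp (-δ₀ * (recordRNat F Mc k (recordK₀ F Mc k + m) : ℝ) / 2) +
            32 * E₀ * C₉ ^ 2 * Real.exp (B12Decay510.delta1 δ₀ κ Mg * Mg * c₁) * K₀' * K₁ *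
              Real.exp (-(B12Decay510.delta1 δ₀ κ Mg) * Rsep m) := by
  classical
  intro F a₀ ε₂₉ α₀ α₁ hα₀ hα₁ Mc k v Nin Rsep ιC hFmt hsw hResp hreg hGk hinj hsepW hsepF hNin hwin hleaf μ ν z
  letI θ := thetaFill F a₀ ε₂₉; letI := θ.instVβ₁; letI := θ.instVβ₂; letI := θ.instιβ
  have hFmtC := formatPlusG_chartSwap hFmt hsw
  have hnegW : ∀ (n : ℕ) (z : Fin 4 → ℤ), (∀ l, 2 * |z l| < (Nin n : ℤ)) → ∀ l, 2 * |(-z) l| < (Nin n : ℤ) := fun n z hz l => by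
    simpa only [Pi.neg_apply, abs_neg] using hz l
  filter_upwards [hwin z] with m hm
  refine twoVol_pvolOf_of_rows_trace F (recordTermsAx F a₀ ε₂₉) θ.ρ8 θ.bV k v
    (fun n => recordUc F Mc k α₀ α₁ (recordK₀ F Mc k + n)) (fun n => recordCoords F Mc k (recordK₀ F Mc k + n))
    (fun n => recordChartJ F Mc k (recordK₀ F Mc k + n))
    (fun n X => recordDom44J F Mc k (recordK₀ F Mc k + n) X (min (1 / 4 : ℝ) (min α₁ (α₀ / 36))))
    (fun n => recordAct F (recordK₀ F Mc k + n)) (fun n => recordToG F (recordK₀ F Mc k + n)) (fun n => recordAdJ F (recordK₀ F Mc k + n))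
    (flipJC F θ (recordAStar F a₀ ε₂₉) Mc k (recordK₀ F Mc k)) (fun n => recordK₀ F Mc k + n)
    (fun n a (y : RespLabel F k (recordK₀ F Mc k + n)) => recordGkJC F θ k (recordK₀ F Mc k + n) a y) ιC
    (N := fun n => recordRNat F Mc k (recordK₀ F Mc k + n)) (Nin := Nin) (Rsep := Rsep) (K₁ := K₁)
    hE₀ hκ.le hC₉ hδ₀.le hMg hK₀' hFmtC (chart44DJ_record F Mc k hα₀ hα₁)
    (chartEquivariant_members Mc k (recordK₀ F Mc k)) (noInvariantCovector_members (recordK₀ F Mc k))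
    (chart_cut_members_JC F θ (recordAStar F a₀ ε₂₉) Mc k (recordK₀ F Mc k) _)
    ?_ ?_ ?_ ?_ hinj hNin ?_ ?_ (fun n => (hleaf n).1) (fun n => (hleaf n).2) ?_ m μ ν z hm
  · exact fun n a X y => (response9D_flipJC F θ a Mc k (recordK₀ F Mc k) (hResp a)).2.2.1 n X y
  · exact (response9D_flipJC F θ (recordAStar F a₀ ε₂₉) Mc k (recordK₀ F Mc k) (hResp _)).2.2.2.1
  · exact fun n a X hX μ' z' hz' => (response9D_flipJC F θ a Mc k (recordK₀ F Mc k) (hResp a)).2.2.2.2.1 n X hX μ' z' hz'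
  · exact (response9D_flipJC F θ (recordAStar F a₀ ε₂₉) Mc k (recordK₀ F Mc k) (hResp _)).2.2.2.2.2
  · intro n X hX μ' z' hz'
    rw [flipJC_e]
    exact hsepW n X hX μ' (-z') (hnegW n z' hz')
  · intro n X' hX' μ' z' hz'
    rw [flipJC_e]
    exact hsepF n X' hX' μ' (-z') (hnegW n z' hz')
  · exact fun n => ⟨(hreg n).2, (hreg n).1, fun a μ' z' => hGk n a _⟩

/-- ★★★ **`kstep_joinT_at_record` — RUN LEVEL, THE RECORD INSTANTIATION (PROVED — no `sorry`: ★★★ `recordTwoVol_of_rows_JC` per member + §E `recordPvolTwoVolExpOnRunsAx_of_members`).**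
ONE CENTRED CHART `ιC`: ⁸'s consequent AS SIGNED (`FormatPlusG` at `recordEmbJ` along `]0, γ₀]`-runs, D1 verbatim) · the swap row to `ιC` (D13 identity; for `ιC := recordEmbJC` it is
`recordBgFieldC B = recordAct (combTransporter …) …`, sheet §2) · PER COLOUR ★★ DEF-1's `Response9DAtJC` (D9, centred in both blocks; window `recordRNat`, (4.4) domains `recordDom44J … α₂`)
· `IotaRowAt`-type and response-link identities for `ιC ∕ recordGkJC` (D13) · geometry at the names: (G0) `recordDomEmbCtr` injective off `recordWrapCtr`; (G1)(G2) LARGE-OR-FAR at a DISPLAYED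
separation `Rsep k n` for an inner window `Nin k n` (✓`recordR_le_distC_of_onSeamCtr` is the seam half; inner-window labels sit `≈ recordR − Nin∕2` from the seam, so `Rsep` is a fraction
of `recordR`, never `recordR` itself); (G3) `Nin ≤ recordRNat`, eventual membership; (G4) `cR·recordN ≤ Rsep` (`0 < cR ≤ 1∕4`) and `recordN∕4 ≤ recordRNat` (✓`recordN_div_four_le_recordR`
+ `recordR ≤ recordRNat`) · leaves (cube-sum at `δ₀∕4`, tree at `κ∕4`)
⟹ **[E] `RecordPvolTwoVolExpOnRunsAx F a₀ ε₂₉ γ₀ (48E₀C₉²K₀′K₁ + 32E₀C₉²e^{δ₁Mg c₁}K₀′K₁) (δ₁·cR)`**, `δ₁ = delta1 δ₀ κ Mg`.  CONDITIONAL: every displayed row is a hypothesis; nothing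
of Bałaban asserted; K0ᴬ 27238 OPEN; the Yang–Mills mass gap is NOT proved.
[cite: Balaban1987RG1, Thm 1 p.259, (0.20) p.256, (1.7) p.261, (1.18)–(1.22) pp.263–264, (2.3) p.265, (4.4)–(4.5) pp.281–282, (4.14) p.284, (4.35)–(4.37) pp.290–291; Balaban1985Variational, Prop. 9 p.309, (190) p.308] -/
theorem kstep_joinT_at_record {E₀ κ C₉ δ₀ Mg c₁ K₀' K₁ : ℝ}
    (hE₀ : 0 ≤ E₀) (hκ : 0 < κ) (hC₉ : 0 ≤ C₉) (hδ₀ : 0 < δ₀) (hMg : 0 < Mg) (hK₀' : 0 ≤ K₀') :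
    ∀ (F : T4Family) (a₀ ε₂₉ γ₀ α₀ α₁ : ℝ), 0 < α₀ → 0 < α₁ → ∀ (Mc : ℕ) (Nin : ℕ → ℕ → ℕ) (Rsep : ℕ → ℕ → ℝ) (cR : ℝ), 0 < cR → cR ≤ 1 / 4 →
      letI θ := thetaFill F a₀ ε₂₉; letI := θ.instVβ₁; letI := θ.instVβ₂; letI := θ.instιβ
      ∀ ιC : (k n : ℕ) → recordW F a₀ ε₂₉ k (recordK₀ F Mc k + n) → (Fin (recordChartDimJ F (recordK₀ F Mc k + n)) → ℂ),
      (∀ (k : ℕ) (g : ℕ → ℝ), FlowStep.RGEqH k (betaOfRecord₁₃Ax F 2 (thetaFill F a₀ ε₂₉)) g → Step.InInterval γ₀ k g →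
        B12FormatPlus.FormatPlusG (fun n => recordDomSys F Mc k (recordK₀ F Mc k + n)) (fun n => recordBondCount F (recordK₀ F Mc k + n))
          (fun n => recordAct F (recordK₀ F Mc k + n)) (fun n => recordUc F Mc k α₀ α₁ (recordK₀ F Mc k + n))
          (fun n => recordCoords F Mc k (recordK₀ F Mc k + n)) (fun n => recordChartDimJ F (recordK₀ F Mc k + n))
          (fun n => recordChartJ F Mc k (recordK₀ F Mc k + n)) (fun n => recordΦfAx F a₀ ε₂₉ k (FlowStep.prefixOf g k) (recordK₀ F Mc k + n))
          (fun n => recordEmbJ F θ k (recordK₀ F Mc k + n)) (fun n => recordWrapCtr F Mc k (recordK₀ F Mc k + n))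
          (fun n => recordDomEmbCtr F Mc k (recordK₀ F Mc k + n)) (fun n _ => recordCoordProjCtr F (recordK₀ F Mc k + n)) E₀ κ) →
      (∀ (k n : ℕ), ∀ᶠ B in 𝓝 (0 : recordW F a₀ ε₂₉ k (recordK₀ F Mc k + n)), ∀ X : (recordDomSys F Mc k (recordK₀ F Mc k + n)).Dom,
          ∃ g : recordGaugeGrp F (recordK₀ F Mc k + n), ∀ i ∈ recordCoords F Mc k (recordK₀ F Mc k + n) X,
            recordChartJ F Mc k (recordK₀ F Mc k + n) X (ιC k n B) i =
              recordAct F (recordK₀ F Mc k + n) g (recordChartJ F Mc k (recordK₀ F Mc k + n) X (recordEmbJ F θ k (recordK₀ F Mc k + n) B)) i) →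
      (∀ k : ℕ, (∀ a : θ.ιβ, Response9DAtJC F θ a Mc k (recordK₀ F Mc k) (min (1 / 4 : ℝ) (min α₁ (α₀ / 36))) C₉ δ₀) ∧
          (∀ n : ℕ, ContDiffAt ℝ 2 (ιC k n) 0 ∧ ιC k n 0 = 0) ∧
          ∀ (n : ℕ) (a : θ.ιβ) (l : RespLabel F k (recordK₀ F Mc k + n)),
            recordGkJC F θ k (recordK₀ F Mc k + n) a l = fun i => fderiv ℝ (ιC k n) 0 (Pi.single l.1 (Pi.single l.2 (θ.bV a))) i) →
      (∀ k n : ℕ, Set.InjOn (recordDomEmbCtr F Mc k (recordK₀ F Mc k + n)) {X | X ∉ recordWrapCtr F Mc k (recordK₀ F Mc k + n)}) →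
      (∀ (k n : ℕ) (X : (recordDomSys F Mc k (recordK₀ F Mc k + n)).Dom), X ∈ recordWrapCtr F Mc k (recordK₀ F Mc k + n) →
          ∀ (μ : Fin 4) (z : Fin 4 → ℤ), (∀ l, 2 * |z l| < (Nin k n : ℤ)) →
            Rsep k n ≤ (recordSiteGeom F Mc k (recordK₀ F Mc k + n)).distD (recordE F k (recordK₀ F Mc k + n) μ z) X +
              Mg * ((recordDomSys F Mc k (recordK₀ F Mc k + n)).dj X + c₁)) →
      (∀ (k n : ℕ) (X' : (recordDomSys F Mc k (recordK₀ F Mc k + (n + 1))).Dom),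
          (∀ X, X ∉ recordWrapCtr F Mc k (recordK₀ F Mc k + n) → recordDomEmbCtr F Mc k (recordK₀ F Mc k + n) X ≠ X') →
          ∀ (μ : Fin 4) (z : Fin 4 → ℤ), (∀ l, 2 * |z l| < (Nin k n : ℤ)) →
            Rsep k n ≤
              (recordSiteGeom F Mc k (recordK₀ F Mc k + (n + 1))).distD (recordE F k (recordK₀ F Mc k + (n + 1)) μ z) X' +
                Mg * ((recordDomSys F Mc k (recordK₀ F Mc k + (n + 1))).dj X' + c₁)) →
      (∀ k n : ℕ, Nin k n ≤ recordRNat F Mc k (recordK₀ F Mc k + n)) → (∀ (k : ℕ) (z : Fin 4 → ℤ), ∀ᶠ n in atTop, ∀ l, 2 * |z l| < (Nin k n : ℤ)) →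
      (∀ k n : ℕ, cR * (recordN F k (recordK₀ F Mc k + n) : ℝ) ≤ Rsep k n ∧
          (recordN F k (recordK₀ F Mc k + n) : ℝ) / 4 ≤ (recordRNat F Mc k (recordK₀ F Mc k + n) : ℝ)) →
      (∀ k n : ℕ, B12Decay510.CubeSumLeaf (recordSiteGeom F Mc k (recordK₀ F Mc k + n)) (δ₀ / 4) K₁ ∧
          B12Decay510.TreeLeaf (recordCc F Mc k (recordK₀ F Mc k + n)) (κ / 4) K₀') →
      RecordPvolTwoVolExpOnRunsAx F a₀ ε₂₉ γ₀
        (48 * E₀ * C₉ ^ 2 * K₀' * K₁ + 32 * E₀ * C₉ ^ 2 * Real.exp (B12Decay510.delta1 δ₀ κ Mg * Mg * c₁) * K₀' * K₁) (B12Decay510.delta1 δ₀ κ Mg * cR) := by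
  intro F a₀ ε₂₉ γ₀ α₀ α₁ hα₀ hα₁ Mc Nin Rsep cR hcR hcR4 ιC h8 hsw h9 hinj hsepW hsepF hNin hwin hNR hleaf
  have hK₁ : 0 ≤ K₁ :=
    (Finset.sum_nonneg fun c _ => (Real.exp_pos _).le).trans ((hleaf 0 0).1 (recordE F 0 (recordK₀ F Mc 0 + 0) 0 0))
  have hA : 0 ≤ 48 * E₀ * C₉ ^ 2 * K₀' * K₁ := by positivity
  have hB : 0 ≤ 32 * E₀ * C₉ ^ 2 * Real.exp (B12Decay510.delta1 δ₀ κ Mg * Mg * c₁) * K₀' * K₁ := by positivity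
  refine recordPvolTwoVolExpOnRunsAx_of_members F a₀ ε₂₉ γ₀ Mc Rsep hA hB (B12Decay510.delta1_pos hδ₀ hκ hMg)
    (B12Decay510.delta1_le_half δ₀ κ Mg) hcR hcR4 hNR fun n gs hrg hin k hk μ ν z => ?_
  have hrgk : FlowStep.RGEqH k (betaOfRecord₁₃Ax F 2 (thetaFill F a₀ ε₂₉)) gs := fun i hi => hrg i (lt_of_lt_of_le hi hk)
  have hink : Step.InInterval γ₀ k gs := fun i hi => hin i (hi.trans hk)
  exact recordTwoVol_of_rows_JC hE₀ hκ hC₉ hδ₀ hMg hK₀' F a₀ ε₂₉ α₀ α₁ hα₀ hα₁ Mc k (FlowStep.prefixOf gs k) (Nin k) (Rsep k) (ιC k)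
    (h8 k gs hrgk hink) (hsw k) (h9 k).1 (h9 k).2.1 (h9 k).2.2 (hinj k) (hsepW k) (hsepF k) (hNin k) (hwin k) (hleaf k) μ ν z

end KernelStep

end Summit.QuantumFields.YangMills.Theorems.K0AxJoinT

end
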